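import Summits.CriticalPhenomena.CardyFormulaZ2.Theorems.CardySusyWardParafermionFamiliesToSLESixAnchorDataArcs

/-!
# The concrete anchor family (skeleton r4 of line `strip-anchored-vertex-normalisation`,
# crux stmt-CriticalPhenomena-10814), III: the `A`–`B` edges and admissibility of `anchorData δ`

Helper file 2/2 of — and carrying — the registered sub-goal `stub_anchorData_lattice` of the stub
`stub_anchorMoment_of_IP`. With the discrete arcs of `…AnchorDataArcs.lean` (`zdArcB` = the free window
`{L - 1 ≤ s ≤ L, |d| ≤ L - 3}`, `zdArcA` = the rest of the discrete boundary; `s = v₀ + v₁`, `d = v₀ - v₁`,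
`L δ < 2 ≤ (L + 1) δ`, `L ≥ 4`):

* `zdABEdges_eq`: the `A`–`B` edges of `anchorData δ` are `s((L-2,1),(L-1,1))` and `s((1,L-2),(1,L-1))`
  (a `B`-site has `|d| ≤ L - 3` in the free layer; an adjacent `A`-site must have `|d| = L - 2` and level
  `L`, a level-`(L-2)` neighbour having `|d| ≤ L - 2 < L - 1` is no boundary site: `ab_coords`, `omega`);
* `zdABEdges_inner`: each is a side of exactly one inner face (`(L-2,0)`, resp. `(0,L-2)`);
* `isZdAdmissible`: the data are admissible (bounded Jordan carrier, `δ > 0`, nonempty disjoint arcs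
  covering the discrete boundary — no ties —, two `A`–`B` edges).

Assembled, for `0 < δ ≤ 1/4` and `L = ⌈2/δ⌉ - 1 ≥ 7`, in the registered one-line form
`stub_anchorData_lattice`. All elementary. [folklore]
-/

noncomputable section

namespace Summit.CriticalPhenomena.CardyFormulaZ2.Theorems.ParafermionFamiliesToSLESix.StripAnchored

open MeasureTheory Filter Set Metric
open scoped Topology BigOperators
open Literature.Probability.LatticeModels
open Literature.Probability.Percolation (bondPercolation half BondConfig)
open Literature.Probability.RandomPlanarGeometry (DobrushinDomain)
open Summit.CriticalPhenomena.CardyFormulaZ2.Theorems.ParafermionPrecompact.Negative (IsFamily VanishesOn)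
open S5 (anchorDomain)

namespace AnchorLattice

variable {δ : ℝ} {L : ℤ}

/-! ## The level at a small mesh -/

/-- For `0 < δ ≤ 1/4` the level `L = ⌈2/δ⌉ - 1` satisfies `7 ≤ L`, `L δ < 2 ≤ (L + 1) δ`. [folklore] -/
theorem exists_level (hδ : 0 < δ) (hδ4 : δ ≤ 1 / 4) :
    ∃ L : ℤ, 7 ≤ L ∧ (L : ℝ) * δ < 2 ∧ 2 ≤ ((L : ℝ) + 1) * δ := by
  refine ⟨⌈2 / δ⌉ - 1, ?_, ?_, ?_⟩
  · have h8 : (8 : ℝ) ≤ 2 / δ := by rw [le_div_iff₀ hδ]; linarith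
    have h8' : ((8 : ℤ) : ℝ) ≤ ((⌈2 / δ⌉ : ℤ) : ℝ) := by push_cast; exact h8.trans (Int.le_ceil _)
    have h8'' : (8 : ℤ) ≤ ⌈2 / δ⌉ := by exact_mod_cast h8'
    omega
  · have : (((⌈2 / δ⌉ - 1 : ℤ)) : ℝ) < 2 / δ := by push_cast; linarith [Int.ceil_lt_add_one (2 / δ)]
    rwa [lt_div_iff₀ hδ] at this
  · have : 2 / δ ≤ ((⌈2 / δ⌉ - 1 : ℤ) : ℝ) + 1 := by push_cast; linarith [Int.le_ceil (2 / δ)]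
    rwa [div_le_iff₀ hδ] at this

/-! ## The `A`–`B` edges -/

/-- Adjacency in `Ω_δ` for the anchor data. [folklore] -/
theorem adj_iff (hδ : 0 < δ) (hLδ : (L : ℝ) * δ < 2) (hL1 : 2 ≤ ((L : ℝ) + 1) * δ) {x y : Site 2} :
    (discreteDomainGraph (anchorData δ).Ω (anchorData δ).δ).Adj x y ↔ (zdGraph 2).Adj x y ∧
      (|x 0 + x 1| ≤ L ∧ |x 0 - x 1| ≤ L) ∧ (|y 0 + y 1| ≤ L ∧ |y 0 - y 1| ≤ L) :=
  S5.discreteDomainGraph_anchor_adj_iff hδ hLδ hL1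

/-- Lattice adjacency in coordinates. [folklore] -/
theorem adj_coord {x y : Site 2} (h : (zdGraph 2).Adj x y) :
    (y 0 = x 0 + 1 ∧ y 1 = x 1) ∨ (y 0 = x 0 ∧ y 1 = x 1 + 1) ∨
      (x 0 = y 0 + 1 ∧ x 1 = y 1) ∨ (x 0 = y 0 ∧ x 1 = y 1 + 1) := by
  obtain ⟨i, hi | hi⟩ := (zdGraph_adj_iff _ _).1 h
  · have h0 := congrFun hi 0
    have h1 := congrFun hi 1
    fin_cases i <;> simp at h0 h1 <;> omega
  · have h0 := congrFun hi 0
    have h1 := congrFun hi 1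
    fin_cases i <;> simp at h0 h1 <;> omega

/-- The horizontal `A`–`B` edge `s((L-2,1),(L-1,1))` is an `A`–`B` edge. [folklore] -/
theorem edge₁_mem (hδ : 0 < δ) (hLδ : (L : ℝ) * δ < 2) (hL1 : 2 ≤ ((L : ℝ) + 1) * δ) (hL : 4 ≤ L) :
    s((![L - 2, 1] : Site 2), (![L - 1, 1] : Site 2)) ∈ (anchorData δ).zdABEdges := by
  rw [DiscreteDobrushin.mem_zdABEdges_iff, SimpleGraph.mem_edgeSet, adj_iff hδ hLδ hL1]
  refine ⟨⟨(zdGraph_adj_iff _ _).2 ⟨0, Or.inl ?_⟩, ?_, ?_⟩, ⟨_, Sym2.mem_mk_right _ _, ?_⟩,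
    ⟨_, Sym2.mem_mk_left _ _, ?_⟩⟩
  · rw [Site.eq_iff_two]; constructor <;> simp; omega
  · simp only [Matrix.cons_val_zero, Matrix.cons_val_one, Matrix.cons_val_fin_one, abs_le]; omega
  · simp only [Matrix.cons_val_zero, Matrix.cons_val_one, Matrix.cons_val_fin_one, abs_le]; omega
  · rw [mem_zdArcA_iff hδ hLδ hL1 hL, S5.mem_zdBoundary_anchor_iff (E := anchorData δ) rfl rfl hδ
      (by omega) hLδ hL1]
    simp only [Matrix.cons_val_zero, Matrix.cons_val_one, Matrix.cons_val_fin_one, abs_le, le_abs']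
    omega
  · rw [mem_zdArcB_iff hδ hLδ hL1 hL]
    simp only [Matrix.cons_val_zero, Matrix.cons_val_one, Matrix.cons_val_fin_one, abs_le]
    omega

/-- The vertical `A`–`B` edge `s((1,L-2),(1,L-1))` is an `A`–`B` edge. [folklore] -/
theorem edge₂_mem (hδ : 0 < δ) (hLδ : (L : ℝ) * δ < 2) (hL1 : 2 ≤ ((L : ℝ) + 1) * δ) (hL : 4 ≤ L) :
    s((![1, L - 2] : Site 2), (![1, L - 1] : Site 2)) ∈ (anchorData δ).zdABEdges := by
  rw [DiscreteDobrushin.mem_zdABEdges_iff, SimpleGraph.mem_edgeSet, adj_iff hδ hLδ hL1]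
  refine ⟨⟨(zdGraph_adj_iff _ _).2 ⟨1, Or.inl ?_⟩, ?_, ?_⟩, ⟨_, Sym2.mem_mk_right _ _, ?_⟩,
    ⟨_, Sym2.mem_mk_left _ _, ?_⟩⟩
  · rw [Site.eq_iff_two]; constructor <;> simp; omega
  · simp only [Matrix.cons_val_zero, Matrix.cons_val_one, Matrix.cons_val_fin_one, abs_le]; omega
  · simp only [Matrix.cons_val_zero, Matrix.cons_val_one, Matrix.cons_val_fin_one, abs_le]; omega
  · rw [mem_zdArcA_iff hδ hLδ hL1 hL, S5.mem_zdBoundary_anchor_iff (E := anchorData δ) rfl rfl hδ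
      (by omega) hLδ hL1]
    simp only [Matrix.cons_val_zero, Matrix.cons_val_one, Matrix.cons_val_fin_one, abs_le, le_abs']
    omega
  · rw [mem_zdArcB_iff hδ hLδ hL1 hL]
    simp only [Matrix.cons_val_zero, Matrix.cons_val_one, Matrix.cons_val_fin_one, abs_le]
    omega

/-- The integer heart of `zdABEdges_eq`: an `A`-site `a` adjacent to a `B`-site `b` is `(L-1,1)` or
`(1,L-1)`, with `b = (L-2,1)`, resp. `(1,L-2)`. [folklore] -/
theorem ab_coords {a b : Site 2}
    (hco : (b 0 = a 0 + 1 ∧ b 1 = a 1) ∨ (b 0 = a 0 ∧ b 1 = a 1 + 1) ∨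
      (a 0 = b 0 + 1 ∧ a 1 = b 1) ∨ (a 0 = b 0 ∧ a 1 = b 1 + 1))
    (haA : ((|a 0 + a 1| ≤ L ∧ |a 0 - a 1| ≤ L) ∧ (L - 1 ≤ |a 0 + a 1| ∨ L - 1 ≤ |a 0 - a 1|)) ∧
      ¬ (L - 1 ≤ a 0 + a 1 ∧ |a 0 - a 1| ≤ L - 3))
    (hbB : L - 1 ≤ b 0 + b 1 ∧ b 0 + b 1 ≤ L ∧ |b 0 - b 1| ≤ L - 3) :
    (a 0 = L - 1 ∧ a 1 = 1 ∧ b 0 = L - 2 ∧ b 1 = 1) ∨ (a 0 = 1 ∧ a 1 = L - 1 ∧ b 0 = 1 ∧ b 1 = L - 2) := by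
  simp only [abs_le, le_abs'] at haA hbB
  omega

/-- **The `A`–`B` edges of the anchor data** are exactly `s((L-2,1),(L-1,1))` and `s((1,L-2),(1,L-1))`:
a `B`-site has `|d| ≤ L - 3` in the free layer, an adjacent `A`-site must have `|d| = L - 2` and level
`L` (a level-`(L-2)` neighbour has `|d| ≤ L - 2 < L - 1` and is not a boundary site). [folklore] -/
theorem zdABEdges_eq (hδ : 0 < δ) (hLδ : (L : ℝ) * δ < 2) (hL1 : 2 ≤ ((L : ℝ) + 1) * δ) (hL : 4 ≤ L) :
    (anchorData δ).zdABEdges =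
      {s((![L - 2, 1] : Site 2), (![L - 1, 1] : Site 2)), s((![1, L - 2] : Site 2), (![1, L - 1] : Site 2))} := by
  refine Set.Subset.antisymm ?_ ?_
  · intro e he
    induction e using Sym2.ind with
    | h x y =>
      rw [DiscreteDobrushin.mem_zdABEdges_iff, SimpleGraph.mem_edgeSet, adj_iff hδ hLδ hL1] at he
      obtain ⟨⟨hadj, -, -⟩, ⟨a, ha, haA⟩, ⟨b, hb, hbB⟩⟩ := he
      rw [mem_zdArcA_iff hδ hLδ hL1 hL, S5.mem_zdBoundary_anchor_iff (E := anchorData δ) rfl rfl hδ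
        (by omega) hLδ hL1] at haA
      rw [mem_zdArcB_iff hδ hLδ hL1 hL] at hbB
      have hne : ¬ (L - 1 ≤ b 0 + b 1 ∧ |b 0 - b 1| ≤ L - 3) → False := fun h => h ⟨hbB.1, hbB.2.2⟩
      -- `a ≠ b`, so `{a, b} = {x, y}` and `a`, `b` are lattice neighbours
      obtain ⟨hab, hxy⟩ : (zdGraph 2).Adj a b ∧ s(x, y) = s(a, b) := by
        rcases Sym2.mem_iff.1 ha with rfl | rfl <;> rcases Sym2.mem_iff.1 hb with rfl | rfl
        · exact (hne haA.2).elim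
        · exact ⟨hadj, rfl⟩
        · exact ⟨hadj.symm, Sym2.eq_swap⟩
        · exact (hne haA.2).elim
      rw [hxy, Set.mem_insert_iff, Set.mem_singleton_iff]
      rcases ab_coords (adj_coord hab) haA hbB with ⟨h0, h1, h2, h3⟩ | ⟨h0, h1, h2, h3⟩
      · exact Or.inl (Sym2.eq_iff.2 (Or.inr ⟨Site.eq_iff_two.2 ⟨by simp [h0], by simp [h1]⟩,
          Site.eq_iff_two.2 ⟨by simp [h2], by simp [h3]⟩⟩))
      · exact Or.inr (Sym2.eq_iff.2 (Or.inr ⟨Site.eq_iff_two.2 ⟨by simp [h0], by simp [h1]⟩,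
          Site.eq_iff_two.2 ⟨by simp [h2], by simp [h3]⟩⟩))
  · rintro e (rfl | rfl)
    · exact edge₁_mem hδ hLδ hL1 hL
    · exact edge₂_mem hδ hLδ hL1 hL

/-- **Each `A`–`B` edge is a side of exactly one inner face** (`(L-2,0)`, resp. `(0,L-2)`; the other
face containing the edge has level sum `L` and is not inner). [folklore] -/
theorem zdABEdges_inner (hδ : 0 < δ) (hLδ : (L : ℝ) * δ < 2) (hL1 : 2 ≤ ((L : ℝ) + 1) * δ) (hL : 4 ≤ L) :
    ∀ e ∈ (anchorData δ).zdABEdges, ∃! f, (anchorData δ).IsInnerFace f ∧ ∀ x ∈ e, IsCorner x f := by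
  have hinner := S5.isInnerFace_anchor_iff (E := anchorData δ) rfl rfl hδ hLδ hL1
  rw [zdABEdges_eq hδ hLδ hL1 hL]
  rintro e (rfl | rfl)
  · refine ⟨![L - 2, 0], ⟨(hinner _).2 ?_, ?_⟩, ?_⟩
    · simp only [Matrix.cons_val_zero, Matrix.cons_val_one, Matrix.cons_val_fin_one, abs_lt]; omega
    · intro x hx j
      rcases Sym2.mem_iff.1 hx with rfl | rfl <;> fin_cases j <;> simp
      omega
    · rintro g ⟨hg, hgc⟩
      rw [hinner] at hg
      have a0 := hgc _ (Sym2.mem_mk_left _ _) 0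
      have a1 := hgc _ (Sym2.mem_mk_left _ _) 1
      have b0 := hgc _ (Sym2.mem_mk_right _ _) 0
      simp only [Matrix.cons_val_zero, Matrix.cons_val_one, Matrix.cons_val_fin_one] at a0 a1 b0
      rw [Site.eq_iff_two]
      simp only [Matrix.cons_val_zero, Matrix.cons_val_one, Matrix.cons_val_fin_one]
      simp only [abs_lt] at hg
      omega
  · refine ⟨![0, L - 2], ⟨(hinner _).2 ?_, ?_⟩, ?_⟩
    · simp only [Matrix.cons_val_zero, Matrix.cons_val_one, Matrix.cons_val_fin_one, abs_lt]; omega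
    · intro x hx j
      rcases Sym2.mem_iff.1 hx with rfl | rfl <;> fin_cases j <;> simp
      omega
    · rintro g ⟨hg, hgc⟩
      rw [hinner] at hg
      have a0 := hgc _ (Sym2.mem_mk_left _ _) 0
      have a1 := hgc _ (Sym2.mem_mk_left _ _) 1
      have b1 := hgc _ (Sym2.mem_mk_right _ _) 1
      simp only [Matrix.cons_val_zero, Matrix.cons_val_one, Matrix.cons_val_fin_one] at a0 a1 b1
      rw [Site.eq_iff_two]
      simp only [Matrix.cons_val_zero, Matrix.cons_val_one, Matrix.cons_val_fin_one]
      simp only [abs_lt] at hg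
      omega

/-! ## Admissibility -/

/-- **The concrete anchor data are admissible** (`L ≥ 4`, `L δ < 2 ≤ (L + 1) δ`). [folklore] -/
theorem isZdAdmissible (hδ : 0 < δ) (hLδ : (L : ℝ) * δ < 2) (hL1 : 2 ≤ ((L : ℝ) + 1) * δ) (hL : 4 ≤ L) :
    (anchorData δ).IsZdAdmissible where
  isBounded := anchorDomain.isBounded
  delta_pos := hδ
  zdArcA_nonempty := by
    refine ⟨![1, L - 1], ?_⟩
    rw [mem_zdArcA_iff hδ hLδ hL1 hL, S5.mem_zdBoundary_anchor_iff (E := anchorData δ) rfl rfl hδ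
      (by omega) hLδ hL1]
    simp only [Matrix.cons_val_zero, Matrix.cons_val_one, Matrix.cons_val_fin_one, abs_le, le_abs']
    omega
  zdArcB_nonempty := by
    refine ⟨![1, L - 2], ?_⟩
    rw [mem_zdArcB_iff hδ hLδ hL1 hL]
    simp only [Matrix.cons_val_zero, Matrix.cons_val_one, Matrix.cons_val_fin_one, abs_le]
    omega
  disjoint := Set.disjoint_left.2 fun v hA hB => by
    rw [mem_zdArcA_iff hδ hLδ hL1 hL] at hA
    rw [mem_zdArcB_iff hδ hLδ hL1 hL] at hB
    exact hA.2 ⟨hB.1, hB.2.2⟩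
  zdBoundary_subset := fun v hv => by
    by_cases h : L - 1 ≤ v 0 + v 1 ∧ |v 0 - v 1| ≤ L - 3
    · right
      have hbd := (S5.mem_zdBoundary_anchor_iff (E := anchorData δ) rfl rfl hδ (by omega) hLδ hL1 v).1 hv
      exact (mem_zdArcB_iff hδ hLδ hL1 hL v).2 ⟨h.1, (abs_le.1 hbd.1.1).2, h.2⟩
    · left
      exact (mem_zdArcA_iff hδ hLδ hL1 hL v).2 ⟨hv, h⟩
  ncard_zdABEdges_eq_two := by
    rw [zdABEdges_eq hδ hLδ hL1 hL]
    refine Set.ncard_pair fun h => ?_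
    simp only [Sym2.eq_iff, Site.eq_iff_two, Matrix.cons_val_zero, Matrix.cons_val_one,
      Matrix.cons_val_fin_one] at h
    omega
  zdABEdges_inner := zdABEdges_inner hδ hLδ hL1 hL

end AnchorLattice

open AnchorLattice in
/-- **Registered one-line form `stub_anchorData_lattice`** (sub-goal of `stub_anchorMoment_of_IP`, line
`strip-anchored-vertex-normalisation`, skeleton r4): for `0 < δ ≤ 1/4`, with `L = ⌈2/δ⌉ - 1`
(`L δ < 2 ≤ (L + 1) δ`), the concrete anchor data `anchorData δ` are admissible, their discrete free arc is
the free window `{L - 1 ≤ v₀ + v₁ ≤ L, |v₀ - v₁| ≤ L - 3}`, their discrete wired arc is the rest of the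
discrete boundary, and their two `A`–`B` edges are `s((L-2,1),(L-1,1))`, `s((1,L-2),(1,L-1))`. [folklore] -/
theorem stub_anchorData_lattice : ∀ δ : ℝ, 0 < δ → δ ≤ 1 / 4 → ∃ L : ℤ, (L : ℝ) * δ < 2 ∧ 2 ≤ ((L : ℝ) + 1) * δ ∧ (anchorData δ).IsZdAdmissible ∧ (∀ v : Site 2, v ∈ (anchorData δ).zdArcB ↔ (L - 1 ≤ v 0 + v 1 ∧ v 0 + v 1 ≤ L ∧ |v 0 - v 1| ≤ L - 3)) ∧ (∀ v : Site 2, v ∈ (anchorData δ).zdArcA ↔ (v ∈ (anchorData δ).zdBoundary ∧ ¬ (L - 1 ≤ v 0 + v 1 ∧ |v 0 - v 1| ≤ L - 3))) ∧ (anchorData δ).zdABEdges = {s((![L - 2, 1] : Site 2), (![L - 1, 1] : Site 2)), s((![1, L - 2] : Site 2), (![1, L - 1] : Site 2))} := by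
  intro δ hδ hδ4
  obtain ⟨L, hL7, hLδ, hL1⟩ := exists_level hδ hδ4
  exact ⟨L, hLδ, hL1, isZdAdmissible hδ hLδ hL1 (by omega), mem_zdArcB_iff hδ hLδ hL1 (by omega),
    mem_zdArcA_iff hδ hLδ hL1 (by omega), zdABEdges_eq hδ hLδ hL1 (by omega)⟩

end Summit.CriticalPhenomena.CardyFormulaZ2.Theorems.ParafermionFamiliesToSLESix.StripAnchored

end
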